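import Mathlib
import HarnessLib
import Summits.CriticalPhenomena.PercolationContinuityZ3.Theorems.PercNearOneGluingNoHeavyLowerTailSahiGridPatternZProfile
import Summits.CriticalPhenomena.PercolationContinuityZ3.Theorems.PercNearOneGluingNoHeavyLowerTailKnQuestion8AntitheticCubeCharge

/-!
# `NoHeavyLowerTail` (crux stmt-CriticalPhenomena-4575), antithetic vdBHK programme: LEVEL INEQUALITY and FOREIGN-CUBE MIXING

Support file (seat `prim-ineq-gen-7` gen 25; `--supports stmt-CriticalPhenomena-4575`).  Nothing is asserted about the crux; no `sorry`,
no definitions.  Memo: run/shared/lean/prim/prim-ineq-gen-7/FINDING-TREEBLOCK-g25.md §2 and §4.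

CONTEXT.  THEOREM G of the memo (RAA — hence ULEX for every source — for every unicyclic graph whose pendant trees at cycle vertices are
stars or have at most four edges) rests on the TREE-BLOCK LEMMA: the antipodal-Kleitman sum of `Touch(C_n + T)` splits over 'worlds'
`Ω_C ≅ N × B_q` (a poset `N` times a Boolean lattice `B_q`, product order, involution `ι × complement`) and a Z-layer, and each world is
treated LEVEL BY LEVEL.  Two elementary inequalities about upper families of a Boolean lattice carry the whole reduction; both are one
application of KLEITMAN's lemma in the form `#(𝒜 ∩ 𝒟ᶜˢ) ≤ #(𝒜 ∩ 𝒟)` (`SahiGridPattern.card_inter_compls_le`, imported):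

* `AntitheticLevel.level_inequality` (memo §2, LEVEL INEQUALITY).  For a finite index type `M` with a self-map `ι` and two families of
  upper families `𝒜 s, ℬ s ⊆ 2^α` (`s : M`) — i.e. two subsets of `M × 2^α` that are up-sets in the cube coordinate — the antipodal sum with
  the involution `(s,x) ↦ (ι s, xᶜ)` dominates the 'levelwise' sum with `(s,x) ↦ (ι s, x)`:
  `Σ_s Σ_{x ∈ 𝒜 s} ([x ∈ ℬ s] − [x ∈ ℬ (ι s)]) ≤ Σ_s Σ_{x ∈ 𝒜 s} ([x ∈ ℬ s] − [xᶜ ∈ ℬ (ι s)])`.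
  (So `Δ_{N × B_q}(A,B) ≥ Σ_x Δ_N(A^x, B^x)`: a product with a cube is at least the sum of its levels.)
* `AntitheticLevel.mixed_ge_pure` (memo §4, FOREIGN-CUBE MIXING).  For upper families `P, P′, Q, Q′ ⊆ 2^α`:
  `Σ_y (1_P y − 1_{P′} y)(1_Q y − 1_{Q′} y) ≤ Σ_y (1_P y − 1_{P′} yᶜ)(1_Q y − 1_{Q′} yᶜ)`.
  (So the per-pair inequality `(***)` for a tree plus `q` foreign free edges follows from the one for the tree: the free edges of the other
  trees cost nothing.)
-/

namespace Summit.CriticalPhenomena.PercolationContinuityZ3.Theorems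

open Finset
open scoped FinsetFamily

namespace AntitheticLevel

variable {α : Type*} [DecidableEq α] [Fintype α]

/-- `#(S ∩ T)` as an indicator sum over the whole cube. -/
private theorem card_inter_eq_sum (S T : Finset (Finset α)) :
    ((S ∩ T).card : ℤ) = ∑ s : Finset α, (if s ∈ S then (1:ℤ) else 0) * (if s ∈ T then (1:ℤ) else 0) := by
  have : ∀ s : Finset α, (if s ∈ S then (1:ℤ) else 0) * (if s ∈ T then (1:ℤ) else 0) = if s ∈ S ∩ T then (1:ℤ) else 0 := by
    intro s
    by_cases h1 : s ∈ S <;> by_cases h2 : s ∈ T <;> simp [h1, h2, Finset.mem_inter]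
  simp_rw [this]
  rw [Finset.sum_boole, Finset.filter_mem_eq_inter, Finset.univ_inter]

/-- `#(S ∩ Tᶜˢ)` as an indicator sum with the complemented argument. -/
private theorem card_inter_compls_eq_sum (S T : Finset (Finset α)) :
    ((S ∩ Tᶜˢ).card : ℤ) = ∑ s : Finset α, (if s ∈ S then (1:ℤ) else 0) * (if sᶜ ∈ T then (1:ℤ) else 0) := by
  rw [card_inter_eq_sum]
  refine Finset.sum_congr rfl (fun s _ => ?_)
  simp only [Finset.mem_compls]

omit [Fintype α] in
/-- Sum of an indicator over a sub-family: `Σ_{x ∈ S} [x ∈ T] = #(S ∩ T)`. -/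
private theorem sum_ite_mem_eq_card_inter (S T : Finset (Finset α)) :
    ∑ x ∈ S, (if x ∈ T then (1:ℤ) else 0) = ((S ∩ T).card : ℤ) := by
  rw [Finset.sum_boole, Finset.filter_mem_eq_inter]

/-- Sum of a complemented indicator over a sub-family: `Σ_{x ∈ S} [xᶜ ∈ T] = #(S ∩ Tᶜˢ)`. -/
private theorem sum_ite_compl_mem_eq_card_inter (S T : Finset (Finset α)) :
    ∑ x ∈ S, (if xᶜ ∈ T then (1:ℤ) else 0) = ((S ∩ Tᶜˢ).card : ℤ) := by
  have : ∀ x : Finset α, (if xᶜ ∈ T then (1:ℤ) else 0) = (if x ∈ Tᶜˢ then (1:ℤ) else 0) := by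
    intro x; simp only [Finset.mem_compls]
  simp_rw [this]
  rw [Finset.sum_boole, Finset.filter_mem_eq_inter]

/-- **LEVEL INEQUALITY** (memo §2).  Families of upper families `𝒜 s, ℬ s` indexed by a finite type with a self-map `ι`: the levelwise
antipodal sum is dominated by the sum with the product involution `(s,x) ↦ (ι s, xᶜ)`. [this work] -/
theorem level_inequality {M : Type*} [Fintype M] (ι : M → M) (𝒜 ℬ : M → Finset (Finset α))
    (h𝒜 : ∀ s, IsUpperSet ((𝒜 s : Finset (Finset α)) : Set (Finset α)))
    (hℬ : ∀ s, IsUpperSet ((ℬ s : Finset (Finset α)) : Set (Finset α))) :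
    ∑ s : M, ∑ x ∈ 𝒜 s, ((if x ∈ ℬ s then (1:ℤ) else 0) - (if x ∈ ℬ (ι s) then (1:ℤ) else 0))
      ≤ ∑ s : M, ∑ x ∈ 𝒜 s, ((if x ∈ ℬ s then (1:ℤ) else 0) - (if xᶜ ∈ ℬ (ι s) then (1:ℤ) else 0)) := by
  refine Finset.sum_le_sum (fun s _ => ?_)
  rw [Finset.sum_sub_distrib, Finset.sum_sub_distrib, sum_ite_mem_eq_card_inter, sum_ite_mem_eq_card_inter,
    sum_ite_compl_mem_eq_card_inter]
  have h := SahiGridPattern.card_inter_compls_le (h𝒜 s) (hℬ (ι s))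
  have h' : ((𝒜 s ∩ (ℬ (ι s))ᶜˢ).card : ℤ) ≤ ((𝒜 s ∩ ℬ (ι s)).card : ℤ) := by exact_mod_cast h
  linarith

/-- **FOREIGN-CUBE MIXING** (memo §4).  For upper families `P, P′, Q, Q′` of the Boolean lattice, the 'pure' bilinear term is dominated
by the 'mixed' one:  `Σ_y (1_P y − 1_{P′} y)(1_Q y − 1_{Q′} y) ≤ Σ_y (1_P y − 1_{P′} yᶜ)(1_Q y − 1_{Q′} yᶜ)`. [this work] -/
theorem mixed_ge_pure (P P' Q Q' : Finset (Finset α))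
    (hP : IsUpperSet (P : Set (Finset α))) (hP' : IsUpperSet (P' : Set (Finset α)))
    (hQ : IsUpperSet (Q : Set (Finset α))) (hQ' : IsUpperSet (Q' : Set (Finset α))) :
    ∑ y : Finset α, ((if y ∈ P then (1:ℤ) else 0) - (if y ∈ P' then (1:ℤ) else 0)) *
        ((if y ∈ Q then (1:ℤ) else 0) - (if y ∈ Q' then (1:ℤ) else 0))
      ≤ ∑ y : Finset α, ((if y ∈ P then (1:ℤ) else 0) - (if yᶜ ∈ P' then (1:ℤ) else 0)) *
        ((if y ∈ Q then (1:ℤ) else 0) - (if yᶜ ∈ Q' then (1:ℤ) else 0)) := by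
  -- expand both sides into four cardinalities
  have hL : ∑ y : Finset α, ((if y ∈ P then (1:ℤ) else 0) - (if y ∈ P' then (1:ℤ) else 0)) *
        ((if y ∈ Q then (1:ℤ) else 0) - (if y ∈ Q' then (1:ℤ) else 0))
      = ((P ∩ Q).card : ℤ) - (P ∩ Q').card - (P' ∩ Q).card + (P' ∩ Q').card := by
    rw [card_inter_eq_sum, card_inter_eq_sum, card_inter_eq_sum, card_inter_eq_sum, ← Finset.sum_sub_distrib,
      ← Finset.sum_sub_distrib, ← Finset.sum_add_distrib]
    exact Finset.sum_congr rfl (fun s _ => by ring)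
  have hc : ∀ y : Finset α, (if yᶜ ∈ P' then (1:ℤ) else 0) = (if y ∈ P'ᶜˢ then (1:ℤ) else 0) := by
    intro y; simp only [Finset.mem_compls]
  have hd : ∀ y : Finset α, (if yᶜ ∈ Q' then (1:ℤ) else 0) = (if y ∈ Q'ᶜˢ then (1:ℤ) else 0) := by
    intro y; simp only [Finset.mem_compls]
  have hR : ∑ y : Finset α, ((if y ∈ P then (1:ℤ) else 0) - (if yᶜ ∈ P' then (1:ℤ) else 0)) *
        ((if y ∈ Q then (1:ℤ) else 0) - (if yᶜ ∈ Q' then (1:ℤ) else 0))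
      = ((P ∩ Q).card : ℤ) - (P ∩ Q'ᶜˢ).card - (P'ᶜˢ ∩ Q).card + (P'ᶜˢ ∩ Q'ᶜˢ).card := by
    simp_rw [hc, hd]
    rw [card_inter_eq_sum, card_inter_eq_sum, card_inter_eq_sum, card_inter_eq_sum, ← Finset.sum_sub_distrib,
      ← Finset.sum_sub_distrib, ← Finset.sum_add_distrib]
    exact Finset.sum_congr rfl (fun s _ => by ring)
  rw [hL, hR]
  -- Kleitman twice, and `#(P′ᶜˢ ∩ Q′ᶜˢ) = #(P′ ∩ Q′)`
  have h1 : ((P ∩ Q'ᶜˢ).card : ℤ) ≤ (P ∩ Q').card := by exact_mod_cast SahiGridPattern.card_inter_compls_le hP hQ'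
  have h2' : (P'ᶜˢ ∩ Q).card = (Q ∩ P'ᶜˢ).card := by rw [Finset.inter_comm]
  have h2'' : (Q ∩ P'ᶜˢ).card ≤ (Q ∩ P').card := SahiGridPattern.card_inter_compls_le hQ hP'
  have h2''' : (Q ∩ P').card = (P' ∩ Q).card := by rw [Finset.inter_comm]
  have h2 : ((P'ᶜˢ ∩ Q).card : ℤ) ≤ (P' ∩ Q).card := by
    rw [h2', ← h2''']; exact_mod_cast h2''
  have h3 : (P'ᶜˢ ∩ Q'ᶜˢ).card = (P' ∩ Q').card := by rw [← Finset.compls_inter, Finset.card_compls]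
  rw [h3]
  linarith


/-! ### SIGMA-CUBE CHARGE INEQUALITY (appended, gen 25): the cube charge inequality with a PARTIAL reflection

Memo FINDING-TREEBLOCK-g25.md §7b.  In the tree-block lemma the certificate at a level `ρ` of the fibre poset pairs `ρ` with `Φρ` (flip
of the red `v`-cluster and its boundary), not with the antipode `ῑρ`; for one leaf plus foreign free edges `Φ` is the reflection of ONE
cube coordinate.  The inequality below is the common generalisation of `port_charge` (full reflection) and of that case. -/

section Sigma

variable {β : Type*} [DecidableEq β] [Fintype β]

omit [DecidableEq β] [Fintype β] in
/-- The expansion `Σ_x (1_S x − 1_T x)(1_U x − 1_V x) = #(S∩U) − #(S∩V) − #(T∩U) + #(T∩V)`. -/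
private theorem sum_sub_mul_sub (S T U V : Finset (Finset α)) :
    ∑ x : Finset α, ((if x ∈ S then (1:ℤ) else 0) - (if x ∈ T then (1:ℤ) else 0)) *
        ((if x ∈ U then (1:ℤ) else 0) - (if x ∈ V then (1:ℤ) else 0))
      = ((S ∩ U).card : ℤ) - (S ∩ V).card - (T ∩ U).card + (T ∩ V).card := by
  rw [card_inter_eq_sum, card_inter_eq_sum, card_inter_eq_sum, card_inter_eq_sum, ← Finset.sum_sub_distrib,
    ← Finset.sum_sub_distrib, ← Finset.sum_add_distrib]
  exact Finset.sum_congr rfl (fun s _ => by ring)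


/-- **SIGMA-CUBE CHARGE INEQUALITY** (memo §7b).  On the product of two Boolean lattices `2^α × 2^β` let `ι` be the full antipode and
`σ` the antipode of the FIRST coordinate only.  For upper families `a, a′, b, b′` of the product order:
`0 ≤ Σ_p (1_a p − 1_{a′}(ι p))(1_b p − 1_{b′}(ι p)) + #{p : (σp ∈ a ∩ b′ ∧ p ∉ a′ ∪ b) ∨ (σp ∈ a′ ∩ b ∧ p ∉ a ∪ b′)}`
(the count written as an indicator sum).  `β` empty: the port form of the cube charge inequality (`AntitheticCube.port_charge`);
`α` a singleton: the per-pair inequality `(***)` of the tree-block lemma for ONE LEAF with `|β|` foreign free edges (all its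
σ-certificates are realizable); `α` = the `r` leaves at one cycle vertex: the per-pair core of THEOREM E with foreign free edges.
Proof: `mixed_ge_pure` in the `β`-direction for every first coordinate, then `port_charge` on every `α`-fibre. [this work] -/
theorem sigma_cube_charge (a a' b b' : Finset (Finset α × Finset β))
    (ha : IsUpperSet (a : Set (Finset α × Finset β))) (ha' : IsUpperSet (a' : Set (Finset α × Finset β)))
    (hb : IsUpperSet (b : Set (Finset α × Finset β))) (hb' : IsUpperSet (b' : Set (Finset α × Finset β))) :
    0 ≤ (∑ p : Finset α × Finset β,
          ((if p ∈ a then (1:ℤ) else 0) - (if (p.1ᶜ, p.2ᶜ) ∈ a' then (1:ℤ) else 0)) *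
          ((if p ∈ b then (1:ℤ) else 0) - (if (p.1ᶜ, p.2ᶜ) ∈ b' then (1:ℤ) else 0)))
        + ∑ p : Finset α × Finset β,
          (if (((p.1ᶜ, p.2) ∈ a ∧ (p.1ᶜ, p.2) ∈ b' ∧ p ∉ a' ∧ p ∉ b) ∨
               ((p.1ᶜ, p.2) ∈ a' ∧ (p.1ᶜ, p.2) ∈ b ∧ p ∉ a ∧ p ∉ b')) then (1:ℤ) else 0) := by
  -- fibre families
  set aS : Finset β → Finset (Finset α) := fun y => univ.filter (fun x => (x, y) ∈ a) with haS
  set a'S : Finset β → Finset (Finset α) := fun y => univ.filter (fun x => (x, y) ∈ a') with ha'S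
  set bS : Finset β → Finset (Finset α) := fun y => univ.filter (fun x => (x, y) ∈ b) with hbS
  set b'S : Finset β → Finset (Finset α) := fun y => univ.filter (fun x => (x, y) ∈ b') with hb'S
  have maS : ∀ y x, x ∈ aS y ↔ (x, y) ∈ a := fun y x => by simp [haS]
  have ma'S : ∀ y x, x ∈ a'S y ↔ (x, y) ∈ a' := fun y x => by simp [ha'S]
  have mbS : ∀ y x, x ∈ bS y ↔ (x, y) ∈ b := fun y x => by simp [hbS]
  have mb'S : ∀ y x, x ∈ b'S y ↔ (x, y) ∈ b' := fun y x => by simp [hb'S]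
  have upS : ∀ (c : Finset (Finset α × Finset β)), IsUpperSet (c : Set (Finset α × Finset β)) →
      ∀ y, IsUpperSet ((univ.filter (fun x : Finset α => (x, y) ∈ c) : Finset (Finset α)) : Set (Finset α)) := by
    intro c hc y x x' hxx' hx
    rw [Finset.mem_coe, Finset.mem_filter] at hx ⊢
    exact ⟨Finset.mem_univ _, hc (show (x, y) ≤ (x', y) from ⟨hxx', le_rfl⟩) hx.2⟩
  have upT : ∀ (c : Finset (Finset α × Finset β)), IsUpperSet (c : Set (Finset α × Finset β)) →
      ∀ x, IsUpperSet ((univ.filter (fun y : Finset β => (x, y) ∈ c) : Finset (Finset β)) : Set (Finset β)) := by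
    intro c hc x y y' hyy' hy
    rw [Finset.mem_coe, Finset.mem_filter] at hy ⊢
    exact ⟨Finset.mem_univ _, hc (show (x, y) ≤ (x, y') from ⟨le_rfl, hyy'⟩) hy.2⟩
  -- Step 1: mixing in the β-direction for every x
  have hmix : ∀ x : Finset α,
      ∑ y : Finset β, ((if (x, y) ∈ a then (1:ℤ) else 0) - (if (xᶜ, y) ∈ a' then (1:ℤ) else 0)) *
          ((if (x, y) ∈ b then (1:ℤ) else 0) - (if (xᶜ, y) ∈ b' then (1:ℤ) else 0))
      ≤ ∑ y : Finset β, ((if (x, y) ∈ a then (1:ℤ) else 0) - (if (xᶜ, yᶜ) ∈ a' then (1:ℤ) else 0)) *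
          ((if (x, y) ∈ b then (1:ℤ) else 0) - (if (xᶜ, yᶜ) ∈ b' then (1:ℤ) else 0)) := by
    intro x
    have h := mixed_ge_pure (univ.filter (fun y : Finset β => (x, y) ∈ a)) (univ.filter (fun y : Finset β => (xᶜ, y) ∈ a'))
      (univ.filter (fun y : Finset β => (x, y) ∈ b)) (univ.filter (fun y : Finset β => (xᶜ, y) ∈ b'))
      (upT a ha x) (upT a' ha' xᶜ) (upT b hb x) (upT b' hb' xᶜ)
    simpa only [Finset.mem_filter, Finset.mem_univ, true_and] using h
  have hsum_mix : ∑ p : Finset α × Finset β,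
          ((if p ∈ a then (1:ℤ) else 0) - (if (p.1ᶜ, p.2ᶜ) ∈ a' then (1:ℤ) else 0)) *
          ((if p ∈ b then (1:ℤ) else 0) - (if (p.1ᶜ, p.2ᶜ) ∈ b' then (1:ℤ) else 0))
      = ∑ x : Finset α, ∑ y : Finset β, ((if (x, y) ∈ a then (1:ℤ) else 0) - (if (xᶜ, yᶜ) ∈ a' then (1:ℤ) else 0)) *
          ((if (x, y) ∈ b then (1:ℤ) else 0) - (if (xᶜ, yᶜ) ∈ b' then (1:ℤ) else 0)) := by
    rw [Fintype.sum_prod_type]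
  -- Step 2: the pure sum, fibrewise over y, as cardinalities
  have hpure : ∑ x : Finset α, ∑ y : Finset β, ((if (x, y) ∈ a then (1:ℤ) else 0) - (if (xᶜ, y) ∈ a' then (1:ℤ) else 0)) *
          ((if (x, y) ∈ b then (1:ℤ) else 0) - (if (xᶜ, y) ∈ b' then (1:ℤ) else 0))
      = ∑ y : Finset β, (((aS y ∩ bS y).card : ℤ) - (aS y ∩ (b'S y)ᶜˢ).card
          - ((a'S y)ᶜˢ ∩ bS y).card + ((a'S y)ᶜˢ ∩ (b'S y)ᶜˢ).card) := by
    rw [Finset.sum_comm]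
    refine Finset.sum_congr rfl (fun y _ => ?_)
    have e : ∀ x : Finset α, ((if (x, y) ∈ a then (1:ℤ) else 0) - (if (xᶜ, y) ∈ a' then (1:ℤ) else 0)) *
          ((if (x, y) ∈ b then (1:ℤ) else 0) - (if (xᶜ, y) ∈ b' then (1:ℤ) else 0))
        = ((if x ∈ aS y then (1:ℤ) else 0) - (if x ∈ (a'S y)ᶜˢ then (1:ℤ) else 0)) *
          ((if x ∈ bS y then (1:ℤ) else 0) - (if x ∈ (b'S y)ᶜˢ then (1:ℤ) else 0)) := by
      intro x
      simp only [Finset.mem_compls, maS, ma'S, mbS, mb'S]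
    simp_rw [e]
    exact sum_sub_mul_sub (aS y) ((a'S y)ᶜˢ) (bS y) ((b'S y)ᶜˢ)
  -- the certificate family of the fibre at height y (= C_V ∪ C_W of `port_charge` for the fibre quadruple)
  set C : Finset β → Finset (Finset α) := fun y =>
    (((aS y)ᶜˢ ∩ (b'S y)ᶜˢ) \ (a'S y ∪ bS y)) ∪ (((a'S y)ᶜˢ ∩ (bS y)ᶜˢ) \ (aS y ∪ b'S y)) with hC_def
  -- Step 3: port_charge on every α-fibre
  have hport : ∀ y : Finset β,
      0 ≤ (((aS y ∩ bS y).card : ℤ) - (aS y ∩ (b'S y)ᶜˢ).card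
          - ((a'S y)ᶜˢ ∩ bS y).card + ((a'S y)ᶜˢ ∩ (b'S y)ᶜˢ).card) + (C y).card := by
    intro y
    have h := AntitheticCube.port_charge (aS y) (a'S y) (bS y) (b'S y)
      (upS a ha y) (upS a' ha' y) (upS b hb y) (upS b' hb' y)
    have h' : ((aS y ∩ (b'S y)ᶜˢ).card : ℤ) + ((a'S y ∩ (bS y)ᶜˢ).card : ℤ)
        ≤ (aS y ∩ bS y).card + (a'S y ∩ b'S y).card + (C y).card := by
      rw [hC_def]; exact_mod_cast h
    have e1 : ((a'S y)ᶜˢ ∩ bS y).card = (a'S y ∩ (bS y)ᶜˢ).card := AntitheticCube.card_compls_inter _ _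
    have e2 : ((a'S y)ᶜˢ ∩ (b'S y)ᶜˢ).card = (a'S y ∩ b'S y).card := by
      rw [← Finset.compls_inter, Finset.card_compls]
    rw [e1, e2]
    linarith
  -- Step 4: the certificate count is Σ_y #(C y)
  have hcert : ∑ p : Finset α × Finset β,
          (if (((p.1ᶜ, p.2) ∈ a ∧ (p.1ᶜ, p.2) ∈ b' ∧ p ∉ a' ∧ p ∉ b) ∨
               ((p.1ᶜ, p.2) ∈ a' ∧ (p.1ᶜ, p.2) ∈ b ∧ p ∉ a ∧ p ∉ b')) then (1:ℤ) else 0)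
      = ∑ y : Finset β, ((C y).card : ℤ) := by
    have hc2 : ∀ y : Finset β, ((C y).card : ℤ) = ∑ x : Finset α, (if x ∈ C y then (1:ℤ) else 0) := by
      intro y
      rw [Finset.sum_boole, Finset.filter_mem_eq_inter, Finset.univ_inter]
    rw [Fintype.sum_prod_type, Finset.sum_comm]
    simp_rw [hc2]
    refine Finset.sum_congr rfl (fun y _ => Finset.sum_congr rfl (fun x _ => ?_))
    have hiff : (((xᶜ, y) ∈ a ∧ (xᶜ, y) ∈ b' ∧ (x, y) ∉ a' ∧ (x, y) ∉ b) ∨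
            ((xᶜ, y) ∈ a' ∧ (xᶜ, y) ∈ b ∧ (x, y) ∉ a ∧ (x, y) ∉ b')) ↔ x ∈ C y := by
      rw [hC_def]
      simp only [Finset.mem_union, Finset.mem_sdiff, Finset.mem_inter, Finset.mem_compls, maS, ma'S, mbS, mb'S, not_or, and_assoc]
    simp only [hiff]
  -- Assemble
  rw [hcert, hsum_mix]
  have htot : 0 ≤ ∑ y : Finset β, (((aS y ∩ bS y).card : ℤ) - (aS y ∩ (b'S y)ᶜˢ).card
          - ((a'S y)ᶜˢ ∩ bS y).card + ((a'S y)ᶜˢ ∩ (b'S y)ᶜˢ).card) + ∑ y : Finset β, ((C y).card : ℤ) := by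
    rw [← Finset.sum_add_distrib]
    exact Finset.sum_nonneg (fun y _ => hport y)
  have hge : ∑ x : Finset α, ∑ y : Finset β, ((if (x, y) ∈ a then (1:ℤ) else 0) - (if (xᶜ, y) ∈ a' then (1:ℤ) else 0)) *
          ((if (x, y) ∈ b then (1:ℤ) else 0) - (if (xᶜ, y) ∈ b' then (1:ℤ) else 0))
      ≤ ∑ x : Finset α, ∑ y : Finset β, ((if (x, y) ∈ a then (1:ℤ) else 0) - (if (xᶜ, yᶜ) ∈ a' then (1:ℤ) else 0)) *
          ((if (x, y) ∈ b then (1:ℤ) else 0) - (if (xᶜ, yᶜ) ∈ b' then (1:ℤ) else 0)) :=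
    Finset.sum_le_sum (fun x _ => hmix x)
  rw [hpure] at hge
  linarith

end Sigma

end AntitheticLevel

end Summit.CriticalPhenomena.PercolationContinuityZ3.Theorems
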